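import Summits.QuantumFields.YangMills.Theorems.BalabanUVNodesN19KingLocalTwoClass

/-!
# BalabanUVNodes ∕ node N19 (NE7) — PURE-SHELL CLASSES ARE FREE (the sufficiency converse of LOCATED-U5d-2), and THE UN-HYBRID DIRECTION WITH SHELLS: the full binder list
# `HybridNE7` of two-class data from a one-constant matching of the TOTALS plus NE7b's and NE7c's weight bounds

Cell `pub-ymgap` (HUMAN RULING D-0062 Track A ∕ D-0149 width seats), WIDTH SEAT `pub-ymgap-dag-n19-w1` (node n19 = NE7, seat 1 of 3), INTENT-2 (bus l.24514), successor of
this seat's `…Theorems.BalabanUVNodesN19KingLocalTwoClass` (p584100).  Route `Summits/QuantumFields/YangMills/Theses/BalabanUVNodes.lean`, key item K3⁷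
`SpineGivenEndpointR13SepCoPH` (stmt-QuantumFields-20544); filed `--kind proof --supports … --as helper`.  COUNT-NEUTRAL.  THEOREMS ONLY (0 `def`, 0 `sorry`).  ADDITIVE — imports
this seat's `…N19KingLocalTwoClass` (★ `goodSum_sandwich_of_total`, `core_twoClass_of_core_total`) and through it the tree's `Spine/NE7/Targets` (`Core`), `T4MatchingAssembly`
(`HybridNE7`, `hybridNE7_of_relWeightBound`), `T4WeightBudget` (`RelWeightBound`), `T4IndicatorShell` (`ShellWeightBound`), `T4HybridMatching` (`hybridDelta`, `mul_hybridDelta`,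
`summable_hybridDelta`) — CITED BY NAME; modifies nothing.

WHY.  (1) LOCATED-U5d-2 (dag-n19-d g18, bus l.23493; kernel-certified in `…Theorems.BalabanUVNodesN19TargetKeyedUnpartnered` p576376 §1 `right_eq_shell_of_left_eq_zero` ∕
`left_eq_shell_of_right_eq_zero`): at every keyed face of the B-series, the displayed pair `h21 : ShellWeightBound` ∧ `hedge : NE7.Core … (A − shA) (B − shB)` FORCES every good
class carried by only one run (`A = 0` or `B = 0`) to be PURE SHELL in the other run.  That is the NECESSITY half.  §1 here is the SUFFICIENCY half: pure-shell classes can ALWAYS be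
adjoined to a `HybridNE7` datum — same constants, same `δ`, the bad classes untouched — at the sole cost of adding their relative shell mass to NE7c's budget `Wsh`.  So an
un-partnered good class is admissible IFF it is pure shell with summable relative mass: node U5d's option (β)∕(b) (un-partnered classes present off `RAgree`) was never
inconsistent with the displayed binders; it only bills NE7c.  (2) p584100 §1 proved the un-hybrid direction WITHOUT shells; the B-series' `hedge` reads the CORES `A − shA`,
`B − shB`.  §2 adds the shells: with ONE good class per level the whole binder list `HybridNE7` (NE7b ∧ NE7c ∧ `W + Wsh < 1` ∧ `Σδ < ∞` ∧ core) follows from a one-constant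
matching of the TOTALS and the two weight bounds, with `δ ↦ hybridDelta vol δ (W + Wsh)` — the exact converse of `T4MatchingAssembly.HybridNE7.matchingModConstants`.  READING:
with one good class per level N19's `Core` carries no information beyond node U5's total matching plus N20∕N21's weights; it is contentful on its own only where ≥ 2 good
classes must share one constant.
* §1 [folklore, generic `ι`] `sum_union_le_of_nonneg` · `relWeightBound_union_pureShell` · `shellWeightBound_union_pureShell` · ★ `core_union_pureShell` ·
  ★★ `hybridNE7_union_pureShell`.
* §2 [folklore] ★ `goodCoreSum_sandwich_of_total` (generic `ι`) · ★★ `hybridNE7_twoClass_of_total` (`ι = Bool`, `Bad = {true}`; the shell-free case is p584100's `core_twoClass_of_core_total`, cited not restated).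

HONEST FRAMING.  Finite-sum bookkeeping over the tree's shapes [folklore]; NO estimate; NE7 ∕ NE7b ∕ NE7c NOT PRINTED as two-run statements for d = 4 and NOT proved; nothing of
Bałaban's instantiated or asserted; the B-series' record-level data untouched.  Count-neutral; N19 NOT discharged (0∕1); K3⁷ NOT claimed; counts UNMOVED (typed 28∕28 · discharged
5∕27).  Everything PROVED (0 `sorry`, 0 named facts, standard axioms).  One finite four-torus programme at fixed ε — NOT ℝ⁴, NOT infinite volume, NOT OS, NOT a mass gap, NOT the
Clay problem (R4 closes the conditional finite-𝕋⁴ rung `BalabanLadder.UV` only).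
-/

noncomputable section

namespace Summit.QuantumFields.YangMills.BalabanUVNodes.N19PureShellClasses

open Real
open scoped BigOperators
open Summit.QuantumFields.BalabanUV.T4Continuum.Spine.NE7 (Core)
open Literature.MathematicalPhysics.QuantumFieldTheory.Balaban1983to89.T4WeightBudget (RelWeightBound)
open Literature.MathematicalPhysics.QuantumFieldTheory.Balaban1983to89.T4IndicatorShell (ShellWeightBound)
open Literature.MathematicalPhysics.QuantumFieldTheory.Balaban1983to89.T4MatchingAssembly (HybridNE7 hybridNE7_of_relWeightBound)
open Literature.MathematicalPhysics.QuantumFieldTheory.Balaban1983to89.T4HybridMatching (hybridDelta mul_hybridDelta summable_hybridDelta)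

/-! ## §1 Pure-shell classes are free -/
section PureShell

variable {ι : Type*} [DecidableEq ι] {l₀ vol : ℝ} {T U : ℕ → Finset ι} {A B shA shB : ℕ → ℝ → ι → ℝ} {Bad : ℕ → ℝ → Finset ι}
  {W Wsh u δ : ℕ → ℝ}

omit [DecidableEq ι] in
/-- A sum over `T` of reals is below the sum over a disjoint union `T ∪ U` when the extra terms are nonnegative. [folklore] -/
theorem sum_union_le_of_nonneg [DecidableEq ι] {s u : Finset ι} (hdisj : Disjoint s u) {f : ι → ℝ} (hf : ∀ τ ∈ u, 0 ≤ f τ) :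
    ∑ τ ∈ s, f τ ≤ ∑ τ ∈ s ∪ u, f τ := by
  rw [Finset.sum_union hdisj]
  exact le_add_of_nonneg_right (Finset.sum_nonneg hf)

/-- **NE7b SURVIVES THE ADJUNCTION OF NONNEGATIVE CLASSES** [folklore]: `RelWeightBound l₀ T A B Bad W` and a disjoint extra class family `U K` carrying nonnegative term weights in
both runs give `RelWeightBound l₀ (T ∪ U) A B Bad W` — the bad classes and the weights unchanged (the totals only grow). -/
theorem relWeightBound_union_pureShell (hW : RelWeightBound l₀ T A B Bad W) (hdisj : ∀ K, Disjoint (T K) (U K))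
    (hUA : ∀ (K : ℕ) (t : ℝ), |t| ≤ l₀ → ∀ τ ∈ U K, 0 ≤ A K t τ) (hUB : ∀ (K : ℕ) (t : ℝ), |t| ≤ l₀ → ∀ τ ∈ U K, 0 ≤ B K t τ) :
    RelWeightBound l₀ (fun K => T K ∪ U K) A B Bad W where
  bad_subset K t ht := (hW.bad_subset K t ht).trans Finset.subset_union_left
  nonneg := hW.nonneg
  lt_one := hW.lt_one
  summable := hW.summable
  bad_left K t ht := (hW.bad_left K t ht).trans
    (mul_le_mul_of_nonneg_left (sum_union_le_of_nonneg (hdisj K) (hUA K t ht)) (hW.nonneg K))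
  bad_right K t ht := (hW.bad_right K t ht).trans
    (mul_le_mul_of_nonneg_left (sum_union_le_of_nonneg (hdisj K) (hUB K t ht)) (hW.nonneg K))

/-- **NE7c ABSORBS PURE-SHELL CLASSES INTO ITS BUDGET** [folklore]: `ShellWeightBound l₀ T A B shA shB Wsh` and a disjoint extra class family `U K` on which BOTH runs are PURE SHELL
(`A = shA ≥ 0`, `B = shB ≥ 0` — a run-B-only class has `A = shA = 0`, a run-A-only class `B = shB = 0`) with relative shell mass `Σ_{U K} shA ≤ u_K·Σ_{T K} A`,
`Σ_{U K} shB ≤ u_K·Σ_{T K} B`, `0 ≤ u_K`, `Σ u_K < ∞`, give `ShellWeightBound l₀ (T ∪ U) A B shA shB (Wsh + u)`. -/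
theorem shellWeightBound_union_pureShell (hSh : ShellWeightBound l₀ T A B shA shB Wsh) (hdisj : ∀ K, Disjoint (T K) (U K))
    (hUA : ∀ (K : ℕ) (t : ℝ), |t| ≤ l₀ → ∀ τ ∈ U K, A K t τ = shA K t τ ∧ 0 ≤ shA K t τ)
    (hUB : ∀ (K : ℕ) (t : ℝ), |t| ≤ l₀ → ∀ τ ∈ U K, B K t τ = shB K t τ ∧ 0 ≤ shB K t τ)
    (hu0 : ∀ K, 0 ≤ u K) (hus : Summable u)
    (huA : ∀ (K : ℕ) (t : ℝ), |t| ≤ l₀ → ∑ τ ∈ U K, shA K t τ ≤ u K * ∑ τ ∈ T K, A K t τ)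
    (huB : ∀ (K : ℕ) (t : ℝ), |t| ≤ l₀ → ∑ τ ∈ U K, shB K t τ ≤ u K * ∑ τ ∈ T K, B K t τ) :
    ShellWeightBound l₀ (fun K => T K ∪ U K) A B shA shB (fun K => Wsh K + u K) where
  nonneg K := add_nonneg (hSh.nonneg K) (hu0 K)
  summable := hSh.summable.add hus
  sh_nonneg_left K t ht τ hτ := by
    rcases Finset.mem_union.mp hτ with h | h
    · exact hSh.sh_nonneg_left K t ht τ h
    · exact (hUA K t ht τ h).2
  sh_le_left K t ht τ hτ := by
    rcases Finset.mem_union.mp hτ with h | h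
    · exact hSh.sh_le_left K t ht τ h
    · exact ((hUA K t ht τ h).1).symm.le
  sh_nonneg_right K t ht τ hτ := by
    rcases Finset.mem_union.mp hτ with h | h
    · exact hSh.sh_nonneg_right K t ht τ h
    · exact (hUB K t ht τ h).2
  sh_le_right K t ht τ hτ := by
    rcases Finset.mem_union.mp hτ with h | h
    · exact hSh.sh_le_right K t ht τ h
    · exact ((hUB K t ht τ h).1).symm.le
  left K t ht := by
    have hTA : ∑ τ ∈ T K, A K t τ ≤ ∑ τ ∈ T K ∪ U K, A K t τ :=
      sum_union_le_of_nonneg (hdisj K) fun τ hτ => ((hUA K t ht τ hτ).2).trans_eq ((hUA K t ht τ hτ).1).symm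
    simp only [Finset.sum_union (hdisj K)]
    calc ∑ τ ∈ T K, shA K t τ + ∑ τ ∈ U K, shA K t τ ≤ Wsh K * ∑ τ ∈ T K, A K t τ + u K * ∑ τ ∈ T K, A K t τ :=
          add_le_add (hSh.left K t ht) (huA K t ht)
      _ = (Wsh K + u K) * ∑ τ ∈ T K, A K t τ := by ring
      _ ≤ (Wsh K + u K) * ∑ τ ∈ T K ∪ U K, A K t τ := mul_le_mul_of_nonneg_left hTA (add_nonneg (hSh.nonneg K) (hu0 K))
      _ = (Wsh K + u K) * (∑ τ ∈ T K, A K t τ + ∑ τ ∈ U K, A K t τ) := by rw [Finset.sum_union (hdisj K)]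
  right K t ht := by
    have hTB : ∑ τ ∈ T K, B K t τ ≤ ∑ τ ∈ T K ∪ U K, B K t τ :=
      sum_union_le_of_nonneg (hdisj K) fun τ hτ => ((hUB K t ht τ hτ).2).trans_eq ((hUB K t ht τ hτ).1).symm
    simp only [Finset.sum_union (hdisj K)]
    calc ∑ τ ∈ T K, shB K t τ + ∑ τ ∈ U K, shB K t τ ≤ Wsh K * ∑ τ ∈ T K, B K t τ + u K * ∑ τ ∈ T K, B K t τ :=
          add_le_add (hSh.right K t ht) (huB K t ht)
      _ = (Wsh K + u K) * ∑ τ ∈ T K, B K t τ := by ring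
      _ ≤ (Wsh K + u K) * ∑ τ ∈ T K ∪ U K, B K t τ := mul_le_mul_of_nonneg_left hTB (add_nonneg (hSh.nonneg K) (hu0 K))
      _ = (Wsh K + u K) * (∑ τ ∈ T K, B K t τ + ∑ τ ∈ U K, B K t τ) := by rw [Finset.sum_union (hdisj K)]

/-- **★ `Spine.NE7.Core` EXTENDS FOR FREE OVER CLASSES WITH VANISHING CORES** [folklore]: if `Core l₀ vol T Bad P Q δ` and both cores vanish on the extra classes `U K`
(`P = Q = 0` there, for `|t| ≤ l₀`), then `Core l₀ vol (T ∪ U) Bad P Q δ` — the SAME constants `c_K` and the SAME `δ`: the sandwich `e^{c∓volδ}·0 ≶ 0` is an identity. -/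
theorem core_union_pureShell {P Q : ℕ → ℝ → ι → ℝ} (h : Core l₀ vol T Bad P Q δ)
    (hU : ∀ (K : ℕ) (t : ℝ), |t| ≤ l₀ → ∀ τ ∈ U K, P K t τ = 0 ∧ Q K t τ = 0) :
    Core l₀ vol (fun K => T K ∪ U K) Bad P Q δ := by
  intro K
  obtain ⟨c, hc⟩ := h K
  refine ⟨c, fun t ht τ hτ => ?_⟩
  rw [Finset.mem_sdiff, Finset.mem_union] at hτ
  by_cases hT : τ ∈ T K
  · exact hc t ht τ (Finset.mem_sdiff.mpr ⟨hT, hτ.2⟩)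
  · have hτU : τ ∈ U K := hτ.1.resolve_left hT
    obtain ⟨hP, hQ⟩ := hU K t ht τ hτU
    simp [hP, hQ]

/-- **★★ PURE-SHELL CLASSES ARE FREE** [folklore ∘ the three theorems above] — the SUFFICIENCY converse of LOCATED-U5d-2 (`…N19TargetKeyedUnpartnered` §1).  A `HybridNE7` datum on the
classes `T` (weights `W`, shells `Wsh`, remainders `δ`) and a disjoint family `U K` of extra classes that are PURE SHELL IN BOTH RUNS (`A = shA ≥ 0`, `B = shB ≥ 0`; in particular every
class carried by one run only, with its whole weight declared shell in the run that carries it) with relative shell mass `≤ u_K` (`u ≥ 0` summable) and the joint budget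
`W + Wsh + u < 1` give `HybridNE7 l₀ vol (T ∪ U) A B Bad W shA shB (Wsh + u) δ`: same bad classes, same constants, same `δ`.  With D p576376 §1: under `h21 ∧ hedge` an
un-partnered good class is admissible IFF it is pure shell with NE7c-budgeted mass. -/
theorem hybridNE7_union_pureShell (h : HybridNE7 l₀ vol T A B Bad W shA shB Wsh δ) (hdisj : ∀ K, Disjoint (T K) (U K))
    (hUA : ∀ (K : ℕ) (t : ℝ), |t| ≤ l₀ → ∀ τ ∈ U K, A K t τ = shA K t τ ∧ 0 ≤ shA K t τ)
    (hUB : ∀ (K : ℕ) (t : ℝ), |t| ≤ l₀ → ∀ τ ∈ U K, B K t τ = shB K t τ ∧ 0 ≤ shB K t τ)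
    (hu0 : ∀ K, 0 ≤ u K) (hus : Summable u) (hlt : ∀ K, W K + (Wsh K + u K) < 1)
    (huA : ∀ (K : ℕ) (t : ℝ), |t| ≤ l₀ → ∑ τ ∈ U K, shA K t τ ≤ u K * ∑ τ ∈ T K, A K t τ)
    (huB : ∀ (K : ℕ) (t : ℝ), |t| ≤ l₀ → ∑ τ ∈ U K, shB K t τ ≤ u K * ∑ τ ∈ T K, B K t τ) :
    HybridNE7 l₀ vol (fun K => T K ∪ U K) A B Bad W shA shB (fun K => Wsh K + u K) δ :=
  hybridNE7_of_relWeightBound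
    (relWeightBound_union_pureShell h.weight hdisj (fun K t ht τ hτ => ((hUA K t ht τ hτ).2).trans_eq ((hUA K t ht τ hτ).1).symm)
      (fun K t ht τ hτ => ((hUB K t ht τ hτ).2).trans_eq ((hUB K t ht τ hτ).1).symm))
    (shellWeightBound_union_pureShell h.shell hdisj hUA hUB hu0 hus huA huB) hlt h.summable
    (core_union_pureShell (P := fun K t τ => A K t τ - shA K t τ) (Q := fun K t τ => B K t τ - shB K t τ) h.core
      fun K t ht τ hτ => ⟨sub_eq_zero.mpr (hUA K t ht τ hτ).1, sub_eq_zero.mpr (hUB K t ht τ hτ).1⟩)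

end PureShell

/-! ## §2 The un-hybrid direction with shells -/
section UnHybrid

variable {ι : Type*} [DecidableEq ι] {l₀ vol : ℝ} {T : ℕ → Finset ι} {A B shA shB : ℕ → ℝ → ι → ℝ} {Bad : ℕ → ℝ → Finset ι} {W Wsh δ : ℕ → ℝ}

/-- **★ THE UN-HYBRID DIRECTION WITH SHELLS** [folklore].  `RelWeightBound l₀ T A B Bad W`, `ShellWeightBound l₀ T A B shA shB Wsh`, `W + Wsh < 1`, and the TOTALS sandwiched with ONE
`t`-independent constant per `K` and radius `vol·δ_K`.  Then the good CORE sums `Σ_{T K ∖ Bad K t} (A − shA)`, `Σ_{T K ∖ Bad K t} (B − shB)` are sandwiched with the SAME constant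
and radius `vol·hybridDelta vol δ (W + Wsh) K = vol·δ_K − log(1 − W_K − Wsh_K)`: in each run `(1 − W − Wsh)·Σ_T ≤ Σ_good − Σ_good sh ≤ Σ_T`. -/
theorem goodCoreSum_sandwich_of_total (hvol : 0 < vol) (hW : RelWeightBound l₀ T A B Bad W) (hSh : ShellWeightBound l₀ T A B shA shB Wsh)
    (hlt : ∀ K, W K + Wsh K < 1)
    (htot : ∀ K : ℕ, ∃ c : ℝ, ∀ t : ℝ, |t| ≤ l₀ →
      Real.exp (c - vol * δ K) * ∑ τ ∈ T K, A K t τ ≤ ∑ τ ∈ T K, B K t τ ∧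
        ∑ τ ∈ T K, B K t τ ≤ Real.exp (c + vol * δ K) * ∑ τ ∈ T K, A K t τ) :
    ∀ K : ℕ, ∃ c : ℝ, ∀ t : ℝ, |t| ≤ l₀ →
      Real.exp (c - vol * hybridDelta vol δ (fun K => W K + Wsh K) K) * ∑ τ ∈ T K \ Bad K t, (A K t τ - shA K t τ)
          ≤ ∑ τ ∈ T K \ Bad K t, (B K t τ - shB K t τ) ∧
        ∑ τ ∈ T K \ Bad K t, (B K t τ - shB K t τ)
          ≤ Real.exp (c + vol * hybridDelta vol δ (fun K => W K + Wsh K) K) * ∑ τ ∈ T K \ Bad K t, (A K t τ - shA K t τ) := by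
  intro K
  obtain ⟨c, hc⟩ := htot K
  refine ⟨c, fun t ht => ?_⟩
  obtain ⟨hlo, hhi⟩ := hc t ht
  have hsub : Bad K t ⊆ T K := hW.bad_subset K t ht
  have h1W : 0 < 1 - (W K + Wsh K) := sub_pos.2 (hlt K)
  -- nonnegativity of terms and shells on `T K`
  have hA0 : ∀ τ ∈ T K, 0 ≤ A K t τ := fun τ hτ => (hSh.sh_nonneg_left K t ht τ hτ).trans (hSh.sh_le_left K t ht τ hτ)
  have hB0 : ∀ τ ∈ T K, 0 ≤ B K t τ := fun τ hτ => (hSh.sh_nonneg_right K t ht τ hτ).trans (hSh.sh_le_right K t ht τ hτ)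
  -- good = total − bad; good shells ≤ total shells ≤ Wsh·total
  have hgA : ∑ τ ∈ T K \ Bad K t, A K t τ = ∑ τ ∈ T K, A K t τ - ∑ τ ∈ Bad K t, A K t τ := Finset.sum_sdiff_eq_sub hsub
  have hgB : ∑ τ ∈ T K \ Bad K t, B K t τ = ∑ τ ∈ T K, B K t τ - ∑ τ ∈ Bad K t, B K t τ := Finset.sum_sdiff_eq_sub hsub
  have hbA := hW.bad_left K t ht
  have hbB := hW.bad_right K t ht
  have hbA0 : 0 ≤ ∑ τ ∈ Bad K t, A K t τ := Finset.sum_nonneg fun τ hτ => hA0 τ (hsub hτ)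
  have hbB0 : 0 ≤ ∑ τ ∈ Bad K t, B K t τ := Finset.sum_nonneg fun τ hτ => hB0 τ (hsub hτ)
  have hshA_le : ∑ τ ∈ T K \ Bad K t, shA K t τ ≤ Wsh K * ∑ τ ∈ T K, A K t τ :=
    (Finset.sum_le_sum_of_subset_of_nonneg Finset.sdiff_subset fun τ hτ _ => hSh.sh_nonneg_left K t ht τ hτ).trans (hSh.left K t ht)
  have hshB_le : ∑ τ ∈ T K \ Bad K t, shB K t τ ≤ Wsh K * ∑ τ ∈ T K, B K t τ :=
    (Finset.sum_le_sum_of_subset_of_nonneg Finset.sdiff_subset fun τ hτ _ => hSh.sh_nonneg_right K t ht τ hτ).trans (hSh.right K t ht)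
  have hshA0 : 0 ≤ ∑ τ ∈ T K \ Bad K t, shA K t τ := Finset.sum_nonneg fun τ hτ => hSh.sh_nonneg_left K t ht τ (Finset.sdiff_subset hτ)
  have hshB0 : 0 ≤ ∑ τ ∈ T K \ Bad K t, shB K t τ := Finset.sum_nonneg fun τ hτ => hSh.sh_nonneg_right K t ht τ (Finset.sdiff_subset hτ)
  rw [Finset.sum_sub_distrib, Finset.sum_sub_distrib]
  -- the two core sums lie in `[(1 − W − Wsh)·Σ_T, Σ_T]`
  have hPA_lo : (1 - (W K + Wsh K)) * ∑ τ ∈ T K, A K t τ ≤ ∑ τ ∈ T K \ Bad K t, A K t τ - ∑ τ ∈ T K \ Bad K t, shA K t τ := by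
    rw [hgA]; nlinarith [hbA, hshA_le]
  have hPA_hi : ∑ τ ∈ T K \ Bad K t, A K t τ - ∑ τ ∈ T K \ Bad K t, shA K t τ ≤ ∑ τ ∈ T K, A K t τ := by rw [hgA]; linarith
  have hQB_lo : (1 - (W K + Wsh K)) * ∑ τ ∈ T K, B K t τ ≤ ∑ τ ∈ T K \ Bad K t, B K t τ - ∑ τ ∈ T K \ Bad K t, shB K t τ := by
    rw [hgB]; nlinarith [hbB, hshB_le]
  have hQB_hi : ∑ τ ∈ T K \ Bad K t, B K t τ - ∑ τ ∈ T K \ Bad K t, shB K t τ ≤ ∑ τ ∈ T K, B K t τ := by rw [hgB]; linarith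
  have key : vol * hybridDelta vol δ (fun K => W K + Wsh K) K = vol * δ K - Real.log (1 - (W K + Wsh K)) :=
    mul_hybridDelta hvol.ne' δ (fun K => W K + Wsh K) K
  have hexp_lo : Real.exp (c - vol * hybridDelta vol δ (fun K => W K + Wsh K) K) = Real.exp (c - vol * δ K) * (1 - (W K + Wsh K)) := by
    rw [key, show c - (vol * δ K - Real.log (1 - (W K + Wsh K))) = (c - vol * δ K) + Real.log (1 - (W K + Wsh K)) by ring, Real.exp_add,
      Real.exp_log h1W]
  have hexp_hi : Real.exp (c + vol * hybridDelta vol δ (fun K => W K + Wsh K) K) = Real.exp (c + vol * δ K) / (1 - (W K + Wsh K)) := by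
    rw [key, show c + (vol * δ K - Real.log (1 - (W K + Wsh K))) = (c + vol * δ K) - Real.log (1 - (W K + Wsh K)) by ring, Real.exp_sub,
      Real.exp_log h1W]
  set PA := ∑ τ ∈ T K \ Bad K t, A K t τ - ∑ τ ∈ T K \ Bad K t, shA K t τ with hPA
  set QB := ∑ τ ∈ T K \ Bad K t, B K t τ - ∑ τ ∈ T K \ Bad K t, shB K t τ with hQB
  constructor
  · rw [hexp_lo]
    calc Real.exp (c - vol * δ K) * (1 - (W K + Wsh K)) * PA ≤ Real.exp (c - vol * δ K) * (1 - (W K + Wsh K)) * ∑ τ ∈ T K, A K t τ :=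
          mul_le_mul_of_nonneg_left hPA_hi (mul_nonneg (Real.exp_pos _).le h1W.le)
      _ = (1 - (W K + Wsh K)) * (Real.exp (c - vol * δ K) * ∑ τ ∈ T K, A K t τ) := by ring
      _ ≤ (1 - (W K + Wsh K)) * ∑ τ ∈ T K, B K t τ := mul_le_mul_of_nonneg_left hlo h1W.le
      _ ≤ QB := hQB_lo
  · rw [hexp_hi]
    have hSA : ∑ τ ∈ T K, A K t τ ≤ PA / (1 - (W K + Wsh K)) := by
      rw [le_div_iff₀ h1W]; linarith [hPA_lo]
    calc QB ≤ ∑ τ ∈ T K, B K t τ := hQB_hi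
      _ ≤ Real.exp (c + vol * δ K) * ∑ τ ∈ T K, A K t τ := hhi
      _ ≤ Real.exp (c + vol * δ K) * (PA / (1 - (W K + Wsh K))) := mul_le_mul_of_nonneg_left hSA (Real.exp_pos _).le
      _ = Real.exp (c + vol * δ K) / (1 - (W K + Wsh K)) * PA := by ring

/-- **★★ THE FULL BINDER LIST `HybridNE7` OF TWO-CLASS DATA FROM THE MATCHING OF THE TOTALS** [folklore ∘ `goodCoreSum_sandwich_of_total` + `T4MatchingAssembly.hybridNE7_of_relWeightBound`]:
class index `Bool`, `T = univ`, `Bad = {true}` (non-empty at every `(K, t)`); NE7b `RelWeightBound l₀ univ A B {true} W`, NE7c `ShellWeightBound l₀ univ A B shA shB Wsh`, `W + Wsh < 1`,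
`Σ δ < ∞`, and a ONE-CLASS `Core` of the TOTALS `A true + A false`, `B true + B false` with remainder `δ` ⇒
`HybridNE7 l₀ vol univ A B {true} W shA shB Wsh (hybridDelta vol δ (W + Wsh))` — the B-series' `hedge` clause on the CORES `A − shA`, `B − shB` included.  The converse of
`HybridNE7.matchingModConstants` for one good class per level. -/
theorem hybridNE7_twoClass_of_total {A B shA shB : ℕ → ℝ → Bool → ℝ} (hvol : 0 < vol)
    (hW : RelWeightBound l₀ (fun _ => (Finset.univ : Finset Bool)) A B (fun _ _ => ({true} : Finset Bool)) W)
    (hSh : ShellWeightBound l₀ (fun _ => (Finset.univ : Finset Bool)) A B shA shB Wsh) (hlt : ∀ K, W K + Wsh K < 1) (hδ : Summable δ)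
    (htot : Core l₀ vol (fun _ => (Finset.univ : Finset Unit)) (fun _ _ => (∅ : Finset Unit))
      (fun K t _ => ∑ τ, A K t τ) (fun K t _ => ∑ τ, B K t τ) δ) :
    HybridNE7 l₀ vol (fun _ => (Finset.univ : Finset Bool)) A B (fun _ _ => ({true} : Finset Bool)) W shA shB Wsh
      (hybridDelta vol δ fun K => W K + Wsh K) := by
  have h := goodCoreSum_sandwich_of_total hvol hW hSh hlt fun K => by
    obtain ⟨c, hc⟩ := htot K
    exact ⟨c, fun t ht => hc t ht () (by simp)⟩
  have hgood : (Finset.univ : Finset Bool) \ {true} = {false} := by decide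
  refine hybridNE7_of_relWeightBound hW hSh hlt
    (summable_hybridDelta hδ (fun K => add_nonneg (hW.nonneg K) (hSh.nonneg K)) hlt (hW.summable.add hSh.summable)) fun K => ?_
  obtain ⟨c, hc⟩ := h K
  refine ⟨c, fun t ht τ hτ => ?_⟩
  have hτ' : τ = false := by simpa using hτ
  have h1 := hc t ht
  simp only [hgood, Finset.sum_singleton] at h1
  subst hτ'
  exact h1

end UnHybrid

end Summit.QuantumFields.YangMills.BalabanUVNodes.N19PureShellClasses

end
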